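import Summits.NavierStokesRegularity.NavierStokesRegularity.Theorems.ExtremiserTransienceNearExtremalTransienceThetaOne
import Literature.Analysis.FluidPDE.AxisymmetricVorticityTransport
import HarnessLib

/-!
# Route `ExtremiserTransience`, crux `NearExtremalTransience` (stmt-NavierStokesRegularity-21883):
# THE CANONICAL FLOW-WISE DEPLETION COEFFICIENT (the stretching efficiency is measurable and minimal)

`--supports stmt-NavierStokesRegularity-21883` (infrastructure for the dynamic stub of the BC3 birth skeleton).
Author: prover seat `ns-et-p1-g0`.

The crux and its dynamic stub ask for a *measurable* flow-wise depletion coefficient `k : ℝ → [0,1]`,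
`|∫⟪ω(t), Du(t) ω(t)⟫| ≤ k(t)·M·‖ω(t)‖₂·‖∇ω(t)‖₂` for every bound `M` of `|u(t)|`, with a small log-time
quadratic mean. The smallest admissible value at time `t` is the STRETCHING EFFICIENCY
`R(t) = |∫⟪ω, Du ω⟫| / (sup|u(t)|·‖ω(t)‖₂·‖∇ω(t)‖₂)` (with `0/0 = 0`). This file proves that along every
classical Leray–Hopf rapidly-decaying-datum flow on `[0,T)` the efficiency IS an admissible coefficient:

* `DepletionLadder.exists_measurable_integral_slice` — for `F` jointly continuous on `S × ℝ³` (`S` measurable)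
  the slice integrals `t ↦ ∫ F(t,x) dx` agree on `S` with a measurable function (zero extension off `S`,
  `ContinuousOn.measurable_piecewise`, `StronglyMeasurable.integral_prod_right'`; no integrability needed —
  Bochner junk included).
* `DepletionLadder.exists_measurable_supNorm_slice` — for `u` jointly continuous on `S × ℝ³` there is a
  measurable `N ≥ 0` with `N(t) = sup|u(t)|` whenever `u(t)` is bounded, `t ∈ S` (countable dense supremum).
* `DepletionLadder.exists_canonical_coefficient` — **the canonical coefficient**: for a classical Leray–Hopf
  rapidly-decaying-datum solution on `[0,T)` there is a measurable `k₀ : ℝ → [0,1]` which (i) satisfies the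
  flow-wise clause at every `t ∈ [0,T)` and (ii) is MINIMAL: `k₀(t) ≤ c` for every `c ≥ 0` satisfying the
  clause at `t`. (The bound `k₀ ≤ 1` — indeed `≤ (2+√3)/9` — is the landed universal constant on the
  admissible slices, `flowwise_of_universal StrainCube.sharp_constant_is_universal`.)
* `DepletionLadder.blockSubextremal_iff_canonical` — consequently the dynamic stub `stub_blockSubextremal` is
  EQUIVALENT to its canonical form: «for every minimal measurable coefficient `k₀` there is an onset `t₁` with
  per-unit-log-block quadratic mean `≤ (θ₀κ)²`» — the form in which an analyst would attack or refute it
  (bound the efficiency `R(t)` itself, block by block).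

WHAT THIS IS NOT: no bound on the efficiency beyond the landed constants; the crux and its dynamic stub stay
open; nothing about Navier–Stokes regularity is settled. [folklore]
-/

noncomputable section

open Set Filter Topology MeasureTheory Function
open scoped InnerProductSpace RealInnerProductSpace ENNReal NNReal ContDiff
open Literature.Analysis.FluidPDE

namespace Summit.NavierStokesRegularity.NavierStokesRegularity.Theorems

-- the problem directory repeats the summit name (`NavierStokesRegularity/NavierStokesRegularity`)
set_option linter.dupNamespace false

namespace DepletionLadder

open Summit.NavierStokesRegularity.NavierStokesRegularity.Theorems.RungReynoldsOne

/-- **Measurable version of slice integrals.** If `F : ℝ → ℝ³ → ℝ` is jointly continuous on `S × ℝ³` for a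
measurable time set `S`, then some measurable `I : ℝ → ℝ` agrees with `t ↦ ∫ F(t,x) dx` on `S` (the
zero extension of `F` off `S × ℝ³` is Borel measurable, and parametric Bochner integrals of jointly
measurable integrands are measurable — including the junk value `0` where `F(t,·)` is not integrable).
[folklore] -/
theorem exists_measurable_integral_slice {F : ℝ → (EuclideanSpace ℝ (Fin 3)) → ℝ} {S : Set ℝ} (hS : MeasurableSet S)
    (hF : ContinuousOn (uncurry F) (S ×ˢ univ)) :
    ∃ I : ℝ → ℝ, Measurable I ∧ ∀ t ∈ S, I t = ∫ x, F t x := by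
  classical
  set G : ℝ × (EuclideanSpace ℝ (Fin 3)) → ℝ := (S ×ˢ (univ : Set (EuclideanSpace ℝ (Fin 3)))).piecewise (uncurry F) 0 with hG
  have hGm : Measurable G :=
    ContinuousOn.measurable_piecewise hF continuousOn_const (hS.prod MeasurableSet.univ)
  have hI : StronglyMeasurable fun t => ∫ x, G (t, x) :=
    hGm.stronglyMeasurable.integral_prod_right'
  refine ⟨fun t => ∫ x, G (t, x), hI.measurable, fun t ht => ?_⟩
  refine integral_congr_ae (Eventually.of_forall fun x => ?_)
  show G (t, x) = F t x
  rw [hG, piecewise_eq_of_mem _ _ _ (mk_mem_prod ht (mem_univ x))]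
  rfl

/-- **Measurable version of the slice sup-norm.** If `u : ℝ → ℝ³ → ℝ³` is jointly continuous on `S × ℝ³`
(`S` measurable), there is a measurable `N : ℝ → ℝ`, `N ≥ 0`, such that for every `t ∈ S` at which `u(t)`
is bounded, `N(t)` is a bound of `|u(t)|` and is below every bound: `N(t) = sup|u(t)|` (supremum over a
countable dense sequence, extended by continuity). [folklore] -/
theorem exists_measurable_supNorm_slice {u : ℝ → (EuclideanSpace ℝ (Fin 3)) → (EuclideanSpace ℝ (Fin 3))} {S : Set ℝ} (hS : MeasurableSet S)
    (hu : ContinuousOn (uncurry u) (S ×ˢ univ)) :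
    ∃ N : ℝ → ℝ, Measurable N ∧ (∀ t, 0 ≤ N t) ∧
      ∀ t ∈ S, ∀ M : ℝ, (∀ x, ‖u t x‖ ≤ M) → N t ≤ M ∧ ∀ x, ‖u t x‖ ≤ N t := by
  classical
  set d : ℕ → (EuclideanSpace ℝ (Fin 3)) := TopologicalSpace.denseSeq (EuclideanSpace ℝ (Fin 3)) with hd
  have hdense : DenseRange d := TopologicalSpace.denseRange_denseSeq (EuclideanSpace ℝ (Fin 3))
  -- the evaluations `t ↦ ‖u t (d n)‖`, zero off `S`
  have hcont : ∀ n, ContinuousOn (fun t => ‖u t (d n)‖) S := fun n => by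
    have h1 : ContinuousOn (fun t : ℝ => ((t, d n) : ℝ × (EuclideanSpace ℝ (Fin 3)))) S :=
      (continuousOn_id.prodMk continuousOn_const)
    exact (hu.comp h1 fun t ht => mk_mem_prod ht (mem_univ _)).norm
  obtain ⟨g, hg⟩ : ∃ g : ℕ → ℝ → ℝ, ∀ n, g n = S.piecewise (fun t => ‖u t (d n)‖) 0 :=
    ⟨_, fun _ => rfl⟩
  have hgm : ∀ n, Measurable (g n) := fun n => by
    rw [hg n]; exact ContinuousOn.measurable_piecewise (hcont n) continuousOn_const hS
  have hg0 : ∀ n t, 0 ≤ g n t := fun n t => by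
    by_cases ht : t ∈ S
    · rw [hg n, piecewise_eq_of_mem _ _ _ ht]; exact norm_nonneg _
    · rw [hg n, piecewise_eq_of_notMem _ _ _ ht]; exact le_rfl
  have hgS : ∀ n, ∀ t ∈ S, g n t = ‖u t (d n)‖ := fun n t ht => by
    rw [hg n, piecewise_eq_of_mem _ _ _ ht]
  refine ⟨fun t => ⨆ n, g n t, Measurable.iSup hgm, fun t => Real.iSup_nonneg fun n => hg0 n t,
    fun t ht M hM => ?_⟩
  have hbdd : BddAbove (range fun n => g n t) := by
    refine ⟨M, ?_⟩
    rintro _ ⟨n, rfl⟩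
    show g n t ≤ M
    rw [hgS n t ht]; exact hM _
  have hle : (⨆ n, g n t) ≤ M := ciSup_le fun n => by
    show g n t ≤ M
    rw [hgS n t ht]; exact hM _
  refine ⟨hle, fun x => ?_⟩
  -- `{x | ‖u t x‖ ≤ N t}` is closed and contains the dense sequence
  have hslice : Continuous (u t) :=
    hu.comp_continuous (continuous_const.prodMk continuous_id) fun x => mk_mem_prod ht (mem_univ x)
  have hclosed : IsClosed {x : (EuclideanSpace ℝ (Fin 3)) | ‖u t x‖ ≤ ⨆ n, g n t} :=
    isClosed_le (continuous_norm.comp hslice) continuous_const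
  have hrange : range d ⊆ {x : (EuclideanSpace ℝ (Fin 3)) | ‖u t x‖ ≤ ⨆ n, g n t} := by
    rintro _ ⟨n, rfl⟩
    show ‖u t (d n)‖ ≤ ⨆ n, g n t
    rw [← hgS n t ht]
    exact le_ciSup hbdd n
  have hx : x ∈ closure (range d) := by rw [hdense.closure_range]; exact mem_univ x
  exact hclosed.closure_subset_iff.2 hrange hx

/-- **THE CANONICAL FLOW-WISE DEPLETION COEFFICIENT.** Let `u` be a classical solution of the unforced
Navier–Stokes system on `ℝ³ × [0,T)` (`ν, T > 0`), Leray–Hopf from its rapidly decaying datum. There is a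
measurable `k₀ : ℝ → [0,1]` such that
(i) for every `t ∈ [0,T)` and every bound `M` of `|u(t)|`:
`|∫⟪curl u(t), Du(t) curl u(t)⟫| ≤ k₀(t)·M·‖curl u(t)‖₂·‖∇curl u(t)‖₂`, and
(ii) `k₀` is minimal: for every `t ∈ [0,T)` and every `c ≥ 0` satisfying (i) at `t`, `k₀(t) ≤ c`.
`k₀(t)` is the stretching efficiency `|∫⟪ω, Du ω⟫|/(sup|u(t)|·‖ω‖₂·‖∇ω‖₂)` (`0/0 = 0`), measurable by
`exists_measurable_integral_slice` / `exists_measurable_supNorm_slice` (the slices are jointly smooth), and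
`≤ (2+√3)/9 < 1` because the slices are admissible (`flowwise_of_universal`). [folklore] -/
theorem exists_canonical_coefficient {ν T : ℝ} (hν : 0 < ν) (hT : 0 < T)
    {u : ℝ → (EuclideanSpace ℝ (Fin 3)) → (EuclideanSpace ℝ (Fin 3))} {p : ℝ → (EuclideanSpace ℝ (Fin 3)) → ℝ}
    (hsol : IsClassicalNSSolutionOn (Ico 0 T) ν 0 u p) (hLH : IsLerayHopfOn T ν 0 (u 0) u)
    (hdec : HasRapidSpatialDecay (u 0)) :
    ∃ k₀ : ℝ → ℝ, Measurable k₀ ∧ (∀ τ, 0 ≤ k₀ τ ∧ k₀ τ ≤ 1) ∧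
      (∀ t ∈ Ico 0 T, ∀ M : ℝ, (∀ x, ‖u t x‖ ≤ M) →
        |∫ x, ⟪curl (u t) x, fderiv ℝ (u t) x (curl (u t) x)⟫_ℝ| ≤
          k₀ t * M * Real.sqrt (∫ x, ‖curl (u t) x‖ ^ 2) *
            Real.sqrt (∫ x, frobeniusNormSq (fderiv ℝ (curl (u t)) x))) ∧
      (∀ t ∈ Ico 0 T, ∀ c : ℝ, 0 ≤ c →
        (∀ M : ℝ, (∀ x, ‖u t x‖ ≤ M) →
          |∫ x, ⟪curl (u t) x, fderiv ℝ (u t) x (curl (u t) x)⟫_ℝ| ≤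
            c * M * Real.sqrt (∫ x, ‖curl (u t) x‖ ^ 2) *
              Real.sqrt (∫ x, frobeniusNormSq (fderiv ℝ (curl (u t)) x))) → k₀ t ≤ c) := by
  have hS : MeasurableSet (Ico (0:ℝ) T) := measurableSet_Ico
  have hU : UniqueDiffOn ℝ (Ico (0:ℝ) T) := uniqueDiffOn_Ico 0 T
  -- joint continuity of the three integrands and of `u`
  have hV : IsSmoothSpaceTimeOn (Ico 0 T) (vorticity u) :=
    hsol.smooth_velocity.isSmoothSpaceTimeOn_vorticity hU
  have hDV : IsSmoothSpaceTimeOn (Ico 0 T) (fun t x => fderiv ℝ (vorticity u t) x) :=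
    hV.fderiv_slice hU
  have hStr : IsSmoothSpaceTimeOn (Ico 0 T) (fun t x => fderiv ℝ (u t) x (vorticity u t x)) :=
    (hsol.smooth_velocity.fderiv_slice hU).clm_apply hV
  have hFrob : Continuous fun L : (EuclideanSpace ℝ (Fin 3)) →L[ℝ] (EuclideanSpace ℝ (Fin 3)) => frobeniusNormSq L := by
    unfold frobeniusNormSq
    exact continuous_finsetSum _ fun i _ =>
      ((ContinuousLinearMap.apply ℝ (EuclideanSpace ℝ (Fin 3)) (stdOrthonormalBasis ℝ (EuclideanSpace ℝ (Fin 3)) i)).continuous).norm.pow 2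
  have cS : ContinuousOn (uncurry fun t x => ⟪curl (u t) x, fderiv ℝ (u t) x (curl (u t) x)⟫_ℝ)
      (Ico 0 T ×ˢ univ) := hV.continuousOn.inner hStr.continuousOn
  have cZ : ContinuousOn (uncurry fun t x => ‖curl (u t) x‖ ^ 2) (Ico 0 T ×ˢ univ) :=
    (hV.continuousOn.norm).pow 2
  have cP : ContinuousOn (uncurry fun t x => frobeniusNormSq (fderiv ℝ (curl (u t)) x))
      (Ico 0 T ×ˢ univ) := hFrob.comp_continuousOn hDV.continuousOn
  obtain ⟨Sf, hSm, hSf⟩ := exists_measurable_integral_slice hS cS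
  obtain ⟨Zf, hZm, hZf⟩ := exists_measurable_integral_slice hS cZ
  obtain ⟨Pf, hPm, hPf⟩ := exists_measurable_integral_slice hS cP
  obtain ⟨N, hNm, hN0, hN⟩ := exists_measurable_supNorm_slice hS hsol.smooth_velocity.continuousOn
  -- every slice is bounded (Tao cover) and admissible for the landed universal constant
  have hbdd : ∀ t ∈ Ico 0 T, ∃ B₀ : ℝ, ∀ x, ‖u t x‖ ≤ B₀ := by
    intro t ht
    have ht' : (t + T) / 2 ∈ Ioo 0 T := ⟨by linarith [ht.1], by linarith [ht.2]⟩
    obtain ⟨q, hsolt, hut, -, -⟩ := stub_taoCover hν hT hsol hLH hdec ht'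
    obtain ⟨B₀, -, hB₀⟩ := exists_forall_norm_le_of_hasBoundedSobolevNormsOn hsolt hut
    exact ⟨B₀, hB₀ t ⟨ht.1, by linarith [ht.2]⟩⟩
  have hκS := flowwise_of_universal StrainCube.sharp_constant_is_universal hν hT hsol hLH hdec
  -- the canonical coefficient
  obtain ⟨D, hD⟩ : ∃ D : ℝ → ℝ, ∀ t, D t = N t * Real.sqrt (Zf t) * Real.sqrt (Pf t) :=
    ⟨_, fun _ => rfl⟩
  have hD0 : ∀ t, 0 ≤ D t := fun t => by
    rw [hD]; exact mul_nonneg (mul_nonneg (hN0 t) (Real.sqrt_nonneg _)) (Real.sqrt_nonneg _)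
  have hDm : Measurable D := by
    have : D = fun t => N t * Real.sqrt (Zf t) * Real.sqrt (Pf t) := funext hD
    rw [this]; exact (hNm.mul hZm.sqrt).mul hPm.sqrt
  obtain ⟨k₀, hk₀⟩ : ∃ k₀ : ℝ → ℝ, ∀ t, k₀ t = min 1 (|Sf t| / D t) := ⟨_, fun _ => rfl⟩
  have hk₀m : Measurable k₀ := by
    have : k₀ = fun t => min 1 (|Sf t| / D t) := funext hk₀
    rw [this]; exact measurable_const.min ((continuous_abs.measurable.comp hSm).div hDm)
  have hk₀01 : ∀ τ, 0 ≤ k₀ τ ∧ k₀ τ ≤ 1 := fun τ => by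
    rw [hk₀]
    exact ⟨le_min zero_le_one (div_nonneg (abs_nonneg _) (hD0 τ)), min_le_left _ _⟩
  refine ⟨k₀, hk₀m, hk₀01, fun t ht M hM => ?_, fun t ht c hc hcl => ?_⟩
  · -- (i) the clause
    obtain ⟨hNM, hNx⟩ := hN t ht M hM
    have hM0 : 0 ≤ M := (norm_nonneg _).trans (hM 0)
    set Z := ∫ x, ‖curl (u t) x‖ ^ 2 with hZ
    set P := ∫ x, frobeniusNormSq (fderiv ℝ (curl (u t)) x) with hP
    set J := ∫ x, ⟪curl (u t) x, fderiv ℝ (u t) x (curl (u t) x)⟫_ℝ with hJ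
    have hDt : D t = N t * Real.sqrt Z * Real.sqrt P := by
      simp only [hD, hZf t ht, hPf t ht, hZ, hP]
    have hSt : Sf t = J := by rw [hSf t ht]
    have hJD : |J| ≤ D t := by
      have h := hκS t ht (N t) hNx
      rw [hDt]
      refine h.trans ?_
      have hnn : 0 ≤ N t * Real.sqrt Z * Real.sqrt P := by have := hN0 t; positivity
      have := mul_le_mul_of_nonneg_right sharp_constant_lt_one.le hnn
      linarith [this]
    have hrhs0 : 0 ≤ k₀ t * M * Real.sqrt Z * Real.sqrt P :=
      mul_nonneg (mul_nonneg (mul_nonneg (hk₀01 t).1 hM0) (Real.sqrt_nonneg _)) (Real.sqrt_nonneg _)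
    rcases (hD0 t).eq_or_lt with hD00 | hDpos
    · -- degenerate slice: `D t = 0` forces `J = 0`
      have : |J| ≤ 0 := hJD.trans (le_of_eq hD00.symm)
      linarith [abs_nonneg J]
    · have hk : k₀ t = |J| / D t := by
        rw [hk₀, hSt]
        exact min_eq_right ((div_le_one hDpos).2 hJD)
      rw [hk, hDt]
      have hq0 : 0 ≤ |J| / (N t * Real.sqrt Z * Real.sqrt P) := by rw [← hDt]; positivity
      have hsq : 0 ≤ Real.sqrt Z * Real.sqrt P := by positivity
      calc |J| = |J| / (N t * Real.sqrt Z * Real.sqrt P) * (N t * Real.sqrt Z * Real.sqrt P) := by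
            rw [← hDt]; field_simp
        _ = |J| / (N t * Real.sqrt Z * Real.sqrt P) * N t * Real.sqrt Z * Real.sqrt P := by ring
        _ ≤ |J| / (N t * Real.sqrt Z * Real.sqrt P) * M * Real.sqrt Z * Real.sqrt P := by
            have h1 := mul_le_mul_of_nonneg_left hNM hq0
            have h2 := mul_le_mul_of_nonneg_right h1 hsq
            simpa [mul_assoc] using h2
  · -- (ii) minimality
    obtain ⟨B₀, hB₀⟩ := hbdd t ht
    obtain ⟨-, hNx⟩ := hN t ht B₀ hB₀
    have h := hcl (N t) hNx
    rw [← hSf t ht] at h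
    have hDt : D t = N t * Real.sqrt (∫ x, ‖curl (u t) x‖ ^ 2) *
        Real.sqrt (∫ x, frobeniusNormSq (fderiv ℝ (curl (u t)) x)) := by
      simp only [hD, hZf t ht, hPf t ht]
    have h' : |Sf t| ≤ c * D t := by
      rw [hDt]; simpa [mul_assoc] using h
    rw [hk₀]
    rcases (hD0 t).eq_or_lt with hD00 | hDpos
    · rw [← hD00, div_zero]
      exact (min_le_right _ _).trans hc
    · exact (min_le_right _ _).trans ((div_le_iff₀ hDpos).2 h')

/-- Block endpoints of the unit log-blocks from `t₁ < T`: `t₁ ≤ s n ≤ s (n+1) < T` with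
`s n = T − (T−t₁)e^{−n}`. [folklore] -/
theorem logBlock_endpoints {T t₁ : ℝ} (h : t₁ < T) (n : ℕ) :
    t₁ ≤ T - (T - t₁) * Real.exp (-(n : ℝ)) ∧
      T - (T - t₁) * Real.exp (-(n : ℝ)) ≤ T - (T - t₁) * Real.exp (-((n : ℝ) + 1)) ∧
      T - (T - t₁) * Real.exp (-((n : ℝ) + 1)) < T := by
  have hTt₁ : 0 < T - t₁ := sub_pos.2 h
  have e0 : Real.exp (-(n : ℝ)) ≤ 1 := Real.exp_le_one_iff.2 (by simp)
  have e1 : Real.exp (-((n : ℝ) + 1)) ≤ Real.exp (-(n : ℝ)) := Real.exp_le_exp.2 (by linarith)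
  have e2 : 0 < (T - t₁) * Real.exp (-((n : ℝ) + 1)) := mul_pos hTt₁ (Real.exp_pos _)
  refine ⟨by nlinarith, by nlinarith, by linarith⟩

/-- **The registered dynamic stub is equivalent to its canonical form.** The matrix of `stub_blockSubextremal`
(BC3 birth skeleton of stmt-NavierStokesRegularity-21883: SOME measurable coefficient `k ∈ [0,1]` with the
flow-wise clause from an onset `t₁` has per-unit-log-block quadratic mean `≤ (θ₀κ)²`) holds iff EVERY minimal
measurable coefficient `k₀ ∈ [0,1]` (flow-wise clause on all of `[0,T)`, pointwise below every admissible
constant) has, from some onset, per-block quadratic mean `≤ (θ₀κ)²`. (`→`: a minimal `k₀` lies below the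
stub's `k` on `[t₁,T)`, and the block integrals are monotone; `←`: the canonical coefficient
`exists_canonical_coefficient` is minimal, and its weight `k₀²/(T−τ)` is interval-integrable,
`intervalIntegrable_coeff_sq_div`.) So the dynamic content of the crux is a statement about the stretching
efficiency `R(t)` itself. [folklore] -/
theorem blockSubextremal_iff_canonical :
    (∃ θ₀ : ℝ, 0 ≤ θ₀ ∧ θ₀ < 1 ∧ ∀ κ : ℝ, (∀ (v : EuclideanSpace ℝ (Fin 3) → EuclideanSpace ℝ (Fin 3)) (M B : ℝ), ContDiff ℝ (⊤ : ℕ∞) v → Literature.Analysis.FluidPDE.VectorCalculus.IsDivFree v → (∀ x, ‖v x‖ ≤ M) → (∀ x, ‖fderiv ℝ v x‖ ≤ B) → (∫⁻ x, ‖iteratedFDeriv ℝ 0 v x‖ₑ ^ 2 < ⊤) → (∫⁻ x, ‖iteratedFDeriv ℝ 1 v x‖ₑ ^ 2 < ⊤) → (∫⁻ x, ‖iteratedFDeriv ℝ 2 v x‖ₑ ^ 2 < ⊤) → |∫ x, ⟪Literature.Analysis.FluidPDE.curl v x, fderiv ℝ v x (Literature.Analysis.FluidPDE.curl v x)⟫_ℝ|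 ≤ κ * M * Real.sqrt (∫ x, ‖Literature.Analysis.FluidPDE.curl v x‖ ^ 2) * Real.sqrt (∫ x, Literature.Analysis.FluidPDE.frobeniusNormSq (fderiv ℝ (Literature.Analysis.FluidPDE.curl v) x))) → ∀ (C ν T : ℝ), 0 < C → 0 < ν → 0 < T → ∀ (u : ℝ → EuclideanSpace ℝ (Fin 3) → EuclideanSpace ℝ (Fin 3)) (p : ℝ → EuclideanSpace ℝ (Fin 3) → ℝ), Literature.Analysis.FluidPDE.IsClassicalNSSolutionOn (Set.Ico 0 T) ν 0 u p → Literature.Analysis.FluidPDE.IsLerayHopfOn T ν 0 (u 0) u → Literature.Analysis.FluidPDE.HasRapidSpatialDecay (u 0) → (∀ᶠ t in 𝓝[<] T, ∀ x, Real.sqrt (T - t) * ‖u t x‖ ≤ C * Real.sqrt ν) → ¬ Literature.Analysis.FluidPDE.HasSmoothExtensionPast ν 0 u T → ∃ t₁ ∈ Set.Ico 0 T, ∃ (k : ℝ → ℝ), Measurable k ∧ (∀ τ, 0 ≤ k τ ∧ k τ ≤ 1) ∧ (∀ t ∈ Set.Ico t₁ T, ∀ M : ℝ, (∀ x, ‖u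 t x‖ ≤ M) → |∫ x, ⟪Literature.Analysis.FluidPDE.curl (u t) x, fderiv ℝ (u t) x (Literature.Analysis.FluidPDE.curl (u t) x)⟫_ℝ| ≤ k t * M * Real.sqrt (∫ x, ‖Literature.Analysis.FluidPDE.curl (u t) x‖ ^ 2) * Real.sqrt (∫ x, Literature.Analysis.FluidPDE.frobeniusNormSq (fderiv ℝ (Literature.Analysis.FluidPDE.curl (u t)) x))) ∧ (∀ t ∈ Set.Ico t₁ T, IntervalIntegrable (fun τ => k τ ^ 2 / (T - τ)) MeasureTheory.volume t₁ t) ∧ (∀ n : ℕ, ∫ τ in (T - (T - t₁) * Real.exp (-(n : ℝ)))..(T - (T - t₁) * Real.exp (-((n : ℝ) + 1))), k τ ^ 2 / (T - τ) ≤ (θ₀ * κ) ^ 2)) ↔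
    (∃ θ₀ : ℝ, 0 ≤ θ₀ ∧ θ₀ < 1 ∧ ∀ κ : ℝ, (∀ (v : EuclideanSpace ℝ (Fin 3) → EuclideanSpace ℝ (Fin 3)) (M B : ℝ), ContDiff ℝ (⊤ : ℕ∞) v → Literature.Analysis.FluidPDE.VectorCalculus.IsDivFree v → (∀ x, ‖v x‖ ≤ M) → (∀ x, ‖fderiv ℝ v x‖ ≤ B) → (∫⁻ x, ‖iteratedFDeriv ℝ 0 v x‖ₑ ^ 2 < ⊤) → (∫⁻ x, ‖iteratedFDeriv ℝ 1 v x‖ₑ ^ 2 < ⊤) → (∫⁻ x, ‖iteratedFDeriv ℝ 2 v x‖ₑ ^ 2 < ⊤) → |∫ x, ⟪Literature.Analysis.FluidPDE.curl v x, fderiv ℝ v x (Literature.Analysis.FluidPDE.curl v x)⟫_ℝ| ≤ κ * M * Real.sqrt (∫ x, ‖Literature.Analysis.FluidPDE.curl v x‖ ^ 2) * Real.sqrt (∫ x, Literature.Analysis.FluidPDE.frobeniusNormSq (fderiv ℝ (Literature.Analysis.FluidPDE.curl v) x))) → ∀ (C ν T : ℝ), 0 < C → 0 < ν → 0 < T →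 ∀ (u : ℝ → EuclideanSpace ℝ (Fin 3) → EuclideanSpace ℝ (Fin 3)) (p : ℝ → EuclideanSpace ℝ (Fin 3) → ℝ), Literature.Analysis.FluidPDE.IsClassicalNSSolutionOn (Set.Ico 0 T) ν 0 u p → Literature.Analysis.FluidPDE.IsLerayHopfOn T ν 0 (u 0) u → Literature.Analysis.FluidPDE.HasRapidSpatialDecay (u 0) → (∀ᶠ t in 𝓝[<] T, ∀ x, Real.sqrt (T - t) * ‖u t x‖ ≤ C * Real.sqrt ν) → ¬ Literature.Analysis.FluidPDE.HasSmoothExtensionPast ν 0 u T → ∀ k₀ : ℝ → ℝ, Measurable k₀ → (∀ τ, 0 ≤ k₀ τ ∧ k₀ τ ≤ 1) → (∀ t ∈ Set.Ico 0 T, ∀ M : ℝ, (∀ x, ‖u t x‖ ≤ M) → |∫ x, ⟪Literature.Analysis.FluidPDE.curl (u t) x, fderiv ℝ (u t) x (Literature.Analysis.FluidPDE.curl (u t) x)⟫_ℝ| ≤ k₀ t * M * Real.sqrt (∫ x, ‖Literature.Analysis.FluidPDE.curl (u t) x‖ ^ 2) * Real.sqrt (∫ x, Literature.Analysis.FluidPDE.frobeniusNormSq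 (fderiv ℝ (Literature.Analysis.FluidPDE.curl (u t)) x))) → (∀ t ∈ Set.Ico 0 T, ∀ c : ℝ, 0 ≤ c → (∀ M : ℝ, (∀ x, ‖u t x‖ ≤ M) → |∫ x, ⟪Literature.Analysis.FluidPDE.curl (u t) x, fderiv ℝ (u t) x (Literature.Analysis.FluidPDE.curl (u t) x)⟫_ℝ| ≤ c * M * Real.sqrt (∫ x, ‖Literature.Analysis.FluidPDE.curl (u t) x‖ ^ 2) * Real.sqrt (∫ x, Literature.Analysis.FluidPDE.frobeniusNormSq (fderiv ℝ (Literature.Analysis.FluidPDE.curl (u t)) x))) → k₀ t ≤ c) → ∃ t₁ ∈ Set.Ico 0 T, (∀ n : ℕ, ∫ τ in (T - (T - t₁) * Real.exp (-(n : ℝ)))..(T - (T - t₁) * Real.exp (-((n : ℝ) + 1))), k₀ τ ^ 2 / (T - τ) ≤ (θ₀ * κ) ^ 2)) := by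
  constructor
  · rintro ⟨θ₀, hθ0, hθ1, H⟩
    refine ⟨θ₀, hθ0, hθ1, fun κ hκ C ν T hC hν hT u p hsol hLH hdec hrate hext k₀ hk₀m hk₀01 hcl hmin => ?_⟩
    obtain ⟨t₁, ht₁, k, hkm, hk01, hflow, -, hblock⟩ := H κ hκ C ν T hC hν hT u p hsol hLH hdec hrate hext
    refine ⟨t₁, ht₁, fun n => (le_trans ?_ (hblock n))⟩
    obtain ⟨h1, h2, h3⟩ := logBlock_endpoints ht₁.2 n
    refine intervalIntegral.integral_mono_on h2
      (intervalIntegrable_coeff_sq_div hk₀m hk₀01 h2 h3) (intervalIntegrable_coeff_sq_div hkm hk01 h2 h3)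
      fun τ hτ => ?_
    have hτ' : τ ∈ Set.Ico t₁ T := ⟨h1.trans hτ.1, lt_of_le_of_lt hτ.2 h3⟩
    have hle : k₀ τ ≤ k τ :=
      hmin τ ⟨ht₁.1.trans hτ'.1, hτ'.2⟩ (k τ) (hk01 τ).1 (hflow τ hτ')
    have hTτ : 0 < T - τ := sub_pos.2 hτ'.2
    exact div_le_div_of_nonneg_right (pow_le_pow_left₀ (hk₀01 τ).1 hle 2) hTτ.le
  · rintro ⟨θ₀, hθ0, hθ1, H⟩
    refine ⟨θ₀, hθ0, hθ1, fun κ hκ C ν T hC hν hT u p hsol hLH hdec hrate hext => ?_⟩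
    obtain ⟨k₀, hk₀m, hk₀01, hcl, hmin⟩ := exists_canonical_coefficient hν hT hsol hLH hdec
    obtain ⟨t₁, ht₁, hblock⟩ :=
      H κ hκ C ν T hC hν hT u p hsol hLH hdec hrate hext k₀ hk₀m hk₀01 hcl hmin
    refine ⟨t₁, ht₁, k₀, hk₀m, hk₀01, fun t ht => hcl t ⟨ht₁.1.trans ht.1, ht.2⟩, fun t ht =>
      intervalIntegrable_coeff_sq_div hk₀m hk₀01 ht.1 ht.2, hblock⟩

end DepletionLadder

end Summit.NavierStokesRegularity.NavierStokesRegularity.Theorems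

end
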